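import Summits.QuantumFields.YangMills.Theorems.DirichletWindowAllSidesCouplingChessboard
import Summits.QuantumFields.YangMills.Theorems.DirichletWindowSparsityOfChessboard
import Summits.QuantumFields.YangMills.Theorems.DirichletWindowCouplingReductionCost
import HarnessLib

/-!
# `DirichletWindow.LargeFieldSparsityAllTori` (item stmt-QuantumFields-20162)

LARGE-FIELD SPARSITY IN EVERY TORUS-LIMIT STATE: for every compact simple `G`, faithful `r`, `t ∈ (0,1)` there are
`C_t, β_t` with, for `β ≥ β_t`, every `μ ∈ infiniteVolumeLimitPoints r.ρ β` (weak limits along tori of ANY sides, odd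
included), every finite set `Z` of plaquettes of `ℤ⁴` and every `η`:
`μ(E_p ≥ η ∀ p ∈ Z) ≤ exp(−|Z|(tβη − C_t))` and `E_μ exp(tβ ∑_{p∈Z} E_p) ≤ exp(C_t |Z|)`.

Pure composition of landed items of the route `DirichletWindow` (seat ym-dw-p1 g3): the glue
`SparsityOfChessboard` (`sparsityOfChessboard_proof`, K1 → K2 → this) applied to K1 `AllSidesCouplingChessboard`
(`allSidesCouplingChessboard_proof`, this seat) and K2 `CouplingReductionCost` (`couplingReductionCost_proof`).
HONEST FRAMING: a Peierls-rate joint sparsity bound for large plaquette fields, uniform over torus-limit states; it is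
NOT volume-uniform clustering and says nothing about the Yang–Mills mass gap.
-/

noncomputable section

namespace Summit.QuantumFields.YangMills.Theorems

/-- **Large-field sparsity in every torus-limit state** (item stmt-QuantumFields-20162), from K1 and K2 by the landed
glue `SparsityOfChessboard`. -/
theorem largeFieldSparsityAllTori_proof :
    Summit.QuantumFields.YangMills.Theses.DirichletWindow.LargeFieldSparsityAllTori :=
  sparsityOfChessboard_proof allSidesCouplingChessboard_proof couplingReductionCost_proof

end Summit.QuantumFields.YangMills.Theorems

end
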